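import Literature.NumberTheory.PAdicHodge.BdRKummerUnitPeriod
import Literature.NumberTheory.GaloisCohomology.KummerMapPadic
import HarnessLib

/-!
# The Kummer exponent `a(σ)` of `BdRKummerUnitPeriod` IS the Kummer cocycle: `κ_{pᵏ}(u) = [σ ↦ ζ_{pᵏ}^{a(σ) mod pᵏ}]`

Topic `Literature/NumberTheory/PAdicHodge`; namespace `Literature.NumberTheory.PAdicHodge.BdRPlusTop`. THEOREMS ONLY
(no definition, no named fact, no instance, no `sorry`). Glue between the `B_dR⁺`-integral of the Kummer cocycle of a unit
(`BdRKummerUnitPeriod`: `σ(ℓ_u) = ℓ_u + a(σ)·t` with `a(σ) = kummerExp σ ∈ ℤ_p`, `σ♭ũ = ε^{a(σ)}ũ`) and the tree's Kummer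
theory (`GaloisCohomology/KummerMapPadic`: `kummerLevel K n x = δ₀(x) ∈ H¹(G_K, μ_n(K̄))`, `kummerPadic = κ_∞`):

for `u ∈ F` with `0 < |u| ≤ 1` and the `p`-power root system `(u_k)_k = rootSeq p u` of §1 there,

* `kummerπ_rootUnitsCarrier` — `u_k` (read in the Galois module `K̄ˣ`) is a LIFT of `u` along the `pᵏ`-th power map of the
  Kummer sequence `0 → μ_{pᵏ} → F̄ˣ → F̄ˣ → 0`;
* ★ `kummerLevel_eq_oneCocycleClass_rootSeq` — hence `κ_{pᵏ}(u) ∈ H¹(G_F, μ_{pᵏ})` is the class of the connecting cocycle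
  `σ ↦ σ(u_k)/u_k` of that lift (`IsSES.δ₀_apply_eq`);
* ★ `muVal_δ₀Cocycle_rootSeq` / `coe_muVal_δ₀Cocycle_rootSeq_eq_epsRaw_pow_toZModPow` — and that cocycle takes the VALUES
  `σ(u_k)/u_k = ζ_{pᵏ}^{k_k(σ)} = ζ_{pᵏ}^{(a(σ) mod pᵏ)}` (`ζ_{pᵏ} = epsRaw p k`, the root system defining Fontaine's `ε`).

So the `p`-adic integer `a(σ) = kummerExp σ` is, level by level, the exponent of the Kummer class `κ_∞(u) ∈ H¹_cont(G_F, ℤ_p(1))`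
(`kummerPadic F p u`, characterised by its levels `cohomologyMap_projHom_kummerPadic`) in the basis `ε = (ζ_{pᵏ})_k` of
`ℤ_p(1) = lim μ_{pᵏ}`: the transformation law `(σ − 1) ℓ_u = a(σ)·t` of `BdRKummerUnitPeriod` reads
«the image of `κ_∞(u)` under `ℤ_p(1) → t·B_dR⁺ = Fil¹`, `ε ↦ t`, is the coboundary of `ℓ_u`» — Bloch–Kato Ex. 3.10.1 for
`𝔾_m` in `B_dR⁺`-currency, stated against the tree's own `κ`.

Crux K★ `stmt-BirchSwinnertonDyer-22226` (line `kato_lever`, [REC] programme floor (d)/(H5) of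
`Cruxes/StarredOptimalManinUnitFiveSeven/Lines/kato-lever-K3-B2-road.md`). BSD / K★ are not proved by any of this.

## References
* S. Bloch, K. Kato (1990), Ex. 3.10.1. [BlochKato1990]
* K. Kato, LNM 1553 (1993), Ch. II 1.4.2, §1.4.4. [Kato1993LNM1553]
* J.-P. Serre, *Galois Cohomology* (1997), II §1.2 (Kummer theory). [SerreGaloisCohomology1997]
-/

noncomputable section

open Field

namespace Literature.NumberTheory.PAdicHodge

namespace BdRPlusTop

open Literature.NumberTheory.GaloisRepresentations
open Literature.NumberTheory.GaloisRepresentations.IsNonarchimedeanLocalField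
open Literature.NumberTheory.GaloisRepresentations.DiscreteGaloisModule
open Literature.NumberTheory.GaloisCohomology
open Literature.AnabelianGeometry.AbsoluteAnabelian
open Literature.AnabelianGeometry.AbsoluteAnabelian.Prop121vii (baseUnitsInvariant)

variable {F : Type} [Field F] [ValuativeRel F] [TopologicalSpace F] [IsNonarchimedeanLocalField F] [CharZero F]
  {p : ℕ} [Fact p.Prime]

omit [CharZero F] [Fact p.Prime] in
/-- `u ∈ F` read in the normed algebraic closure. [folklore] -/
private theorem algebraMap_normedAlgClosure_ne_zero {u : F} (hu : u ≠ 0) :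
    (algebraMap F (NormedAlgClosure F) u) ≠ 0 :=
  (map_ne_zero_iff _ (algebraMap F (NormedAlgClosure F)).injective).2 hu

omit [CharZero F] [Fact p.Prime] in
/-- `toAlgClosure (algebraMap F F̄_normed u) = algebraMap F F̄ u`. [folklore] -/
private theorem toAlgClosure_algebraMap (u : F) :
    NormedAlgClosure.toAlgClosure (algebraMap F (NormedAlgClosure F) u) = algebraMap F (AlgebraicClosure F) u := rfl

variable (p) in
omit [CharZero F] in
/-- **The root `u_k` of the root system as an element of the Galois module `F̄ˣ`** (`UnitsCarrier`).
[cite: SerreGaloisCohomology1997, II §1.2] -/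
theorem rootSeq_toAlgClosure_ne_zero {u : F} (hu : u ≠ 0) (k : ℕ) :
    NormedAlgClosure.toAlgClosure (rootSeq p (algebraMap F (NormedAlgClosure F) u) k) ≠ 0 := by
  change rootSeq p (algebraMap F (NormedAlgClosure F) u) k ≠ 0
  exact rootSeq_ne_zero (p := p) (algebraMap_normedAlgClosure_ne_zero hu) k

omit [CharZero F] in
/-- **`u_k` lifts `u` along the `pᵏ`-th power map of the Kummer sequence**: `pᵏ • (u_k) = (u)` in `F̄ˣ` (additive
notation of the tree's `units F`). [cite: SerreGaloisCohomology1997, II §1.2] -/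
theorem kummerπ_rootUnitsCarrier {u : F} (hu : u ≠ 0) (k : ℕ) :
    (kummerπ F (p ^ k)).hom (UnitsCarrier.ofUnits (Units.mk0 _ (rootSeq_toAlgClosure_ne_zero p hu k))) =
      (baseUnitsInvariant F u hu : UnitsCarrier F) := by
  apply unitsVal_injective F
  refine Units.ext ?_
  rw [kummerπ_hom_apply, unitsVal_zsmul, zpow_natCast, unitsVal_ofUnits, Units.val_pow_eq_pow_val, Units.val_mk0,
    Prop121vii.coe_unitsVal_baseUnitsInvariant, ← toAlgClosure_algebraMap]
  change rootSeq p (algebraMap F (NormedAlgClosure F) u) k ^ p ^ k = algebraMap F (NormedAlgClosure F) u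
  exact rootSeq_pow _ k

omit [CharZero F] in
/-- The invariance side condition of the lift (its image `u` is `G_F`-fixed). [cite: SerreGaloisCohomology1997, II §1.2] -/
theorem kummerπ_rootUnitsCarrier_mem_invariants {u : F} (hu : u ≠ 0) (k : ℕ) :
    (kummerπ F (p ^ k)).hom (UnitsCarrier.ofUnits (Units.mk0 _ (rootSeq_toAlgClosure_ne_zero p hu k))) ∈
      (units F).toTopRep.ρ.invariants := by
  rw [kummerπ_rootUnitsCarrier hu k]
  exact (baseUnitsInvariant F u hu).2

omit [CharZero F] in
/-- ★ **`κ_{pᵏ}(u)` is the class of the connecting cocycle `σ ↦ σ(u_k)/u_k` of the chosen root `u_k`.**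
[cite: SerreGaloisCohomology1997, II §1.2] [cite: Kato1993LNM1553, Ch. II 1.4.2] -/
theorem kummerLevel_eq_oneCocycleClass_rootSeq {u : F} (hu : u ≠ 0) (k : ℕ) :
    kummerLevel F (p ^ k) (pow_pos (Fact.out : p.Prime).pos k) u hu =
      oneCocycleClass _ ((isSES_kummer F (p ^ k) (pow_pos (Fact.out : p.Prime).pos k)).δ₀Cocycle
        (UnitsCarrier.ofUnits (Units.mk0 _ (rootSeq_toAlgClosure_ne_zero p hu k)))
        (kummerπ_rootUnitsCarrier_mem_invariants hu k)) :=
  (isSES_kummer F (p ^ k) (pow_pos (Fact.out : p.Prime).pos k)).δ₀_apply_eq _ _ (kummerπ_rootUnitsCarrier hu k)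

/-- ★ **The connecting cocycle takes the value `σ(u_k)/u_k = ζ_{pᵏ}^{k_k(σ)}`** (`ζ_{pᵏ} = epsRaw p k`, `k_k(σ) =
kummerExpLevel σ k` the level-`k` Kummer exponent of `BdRKummerUnitPeriod`). [cite: SerreGaloisCohomology1997, II §1.2]
[cite: FontaineAsterisque223III, Exp. II §1.2.2] -/
theorem coe_muVal_δ₀Cocycle_rootSeq {u : F} (hu : u ≠ 0) (σ : absoluteGaloisGroup F) (k : ℕ) :
    ((muVal F (p ^ k) (((isSES_kummer F (p ^ k) (pow_pos (Fact.out : p.Prime).pos k)).δ₀Cocycle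
        (UnitsCarrier.ofUnits (Units.mk0 _ (rootSeq_toAlgClosure_ne_zero p hu k)))
        (kummerπ_rootUnitsCarrier_mem_invariants hu k)).1 σ) : (AlgebraicClosure F)ˣ) : AlgebraicClosure F) =
      NormedAlgClosure.toAlgClosure (epsRaw p k) ^
        kummerExpLevel (p := p) σ (algebraMap_normedAlgClosure_ne_zero hu)
          (NormedAlgClosure.smul_algebraMap σ u) k := by
  set hS := isSES_kummer F (p ^ k) (pow_pos (Fact.out : p.Prime).pos k) with hhS
  set w : UnitsCarrier F := UnitsCarrier.ofUnits (Units.mk0 _ (rootSeq_toAlgClosure_ne_zero p hu k)) with hw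
  have h := hS.f_δ₀Cocycle_apply w (kummerπ_rootUnitsCarrier_mem_invariants hu k) σ
  -- read the identity `ι(c σ) = σ w - w` in `F̄ˣ`
  have h' := congrArg (fun v => ((unitsVal F v : (AlgebraicClosure F)ˣ) : AlgebraicClosure F)) h
  simp only at h'
  rw [unitsVal_kummerι] at h'
  rw [h']
  have hσw : ((unitsVal F (units F σ w - w) : (AlgebraicClosure F)ˣ) : AlgebraicClosure F) =
      ((unitsVal F (units F σ w) : (AlgebraicClosure F)ˣ) : AlgebraicClosure F) *
        (((unitsVal F w : (AlgebraicClosure F)ˣ) : AlgebraicClosure F))⁻¹ := by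
    rw [sub_eq_add_neg, unitsVal_add, Units.val_mul]
    congr 1
  rw [hσw, unitsVal_apply, Units.coe_smul, hw, unitsVal_ofUnits, Units.val_mk0, ← NormedAlgClosure.toAlgClosure_smul,
    smul_rootSeq (p := p) σ (algebraMap_normedAlgClosure_ne_zero hu) (NormedAlgClosure.smul_algebraMap σ u) k]
  change (epsRaw p k ^ _ * rootSeq p (algebraMap F (NormedAlgClosure F) u) k) *
      (rootSeq p (algebraMap F (NormedAlgClosure F) u) k)⁻¹ = epsRaw p k ^ _
  rw [mul_assoc, mul_inv_cancel₀ (rootSeq_ne_zero (p := p) (algebraMap_normedAlgClosure_ne_zero hu) k), mul_one]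

/-- ★ **… `= ζ_{pᵏ}^{(a(σ) mod pᵏ)}` with `a(σ) = kummerExp σ ∈ ℤ_p`**: the Kummer exponent of `BdRKummerUnitPeriod` IS the
Kummer cocycle of `u` at every level, in the basis `ζ_{pᵏ} = epsRaw p k` of `μ_{pᵏ}`. [cite: SerreGaloisCohomology1997, II §1.2]
[cite: BlochKato1990, Ex. 3.10.1] [cite: Kato1993LNM1553, Ch. II 1.4.2] -/
theorem coe_muVal_δ₀Cocycle_rootSeq_eq_epsRaw_pow_toZModPow {u : F} (hu : u ≠ 0) (σ : absoluteGaloisGroup F) (k : ℕ) :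
    ((muVal F (p ^ k) (((isSES_kummer F (p ^ k) (pow_pos (Fact.out : p.Prime).pos k)).δ₀Cocycle
        (UnitsCarrier.ofUnits (Units.mk0 _ (rootSeq_toAlgClosure_ne_zero p hu k)))
        (kummerπ_rootUnitsCarrier_mem_invariants hu k)).1 σ) : (AlgebraicClosure F)ˣ) : AlgebraicClosure F) =
      NormedAlgClosure.toAlgClosure (epsRaw p k) ^
        (PadicInt.toZModPow k (kummerExp (p := p) σ (algebraMap_normedAlgClosure_ne_zero hu)
          (NormedAlgClosure.smul_algebraMap σ u))).val := by
  rw [coe_muVal_δ₀Cocycle_rootSeq hu σ k, toZModPow_kummerExp_val]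


/-! ## The Kummer exponent is a crossed homomorphism for `χ`: `a(στ) = a(σ) + χ(σ)·a(τ)` -/

section CocycleLaw

variable {u : NormedAlgClosure F}

/-- Level `n`: `k_n(στ) ≡ k_n(σ) + χ(σ)·k_n(τ) (mod pⁿ)` — apply `στ` to `u_n` in two ways (`σ(ζ_{pⁿ}) = ζ_{pⁿ}^{χ(σ)}`,
tree `GaloisRep.cyclotomicCharacter_spec`). [cite: SerreGaloisCohomology1997, II §1.2] [cite: FontaineAsterisque223III, Exp. II §1.2.2] -/
theorem kummerExpLevel_mul_modEq (hu : u ≠ 0) {σ τ : absoluteGaloisGroup F} (hσu : σ • u = u) (hτu : τ • u = u)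
    (hστu : (σ * τ) • u = u) (n : ℕ) :
    (kummerExpLevel (p := p) (σ * τ) hu hστu n : ZMod (p ^ n)) =
      kummerExpLevel (p := p) σ hu hσu n +
        (((GaloisRep.cyclotomicCharacter F p σ : ℤ_[p]ˣ) : ℤ_[p]).toZModPow n).val * kummerExpLevel (p := p) τ hu hτu n := by
  haveI : NeZero (p ^ n) := ⟨pow_ne_zero n (Fact.out : p.Prime).ne_zero⟩
  have hn := rootSeq_ne_zero (p := p) hu n
  set χn : ℕ := ((((GaloisRep.cyclotomicCharacter F p σ : ℤ_[p]ˣ) : ℤ_[p]).toZModPow n).val) with hχn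
  -- `(στ) u_n` computed in two ways
  have h1 := smul_rootSeq (p := p) (σ * τ) hu hστu n
  have hε : σ • epsRaw p n = (epsRaw p n : NormedAlgClosure F) ^ χn :=
    GaloisRep.cyclotomicCharacter_spec F p σ (epsRaw p n : NormedAlgClosure F) (epsRaw_pow n)
  rw [mul_smul, smul_rootSeq (p := p) τ hu hτu n, smul_mul', smul_pow', hε, smul_rootSeq (p := p) σ hu hσu n, ← pow_mul,
    ← mul_assoc, ← pow_add] at h1
  have h2 := mul_right_cancel₀ hn h1
  -- reduce the exponents modulo `pⁿ`
  rw [pow_eq_pow_mod_of_pow_eq_one (epsRaw_pow n) (χn * _ + _)] at h2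
  have h3 := (isPrimitiveRoot_epsRaw (F := F) (p := p) n).pow_inj (kummerExpLevel_lt (p := p) (σ * τ) hu hστu n)
    (Nat.mod_lt _ (pow_pos (Fact.out : p.Prime).pos n)) h2.symm
  rw [h3, ZMod.natCast_mod, Nat.cast_add, Nat.cast_mul, add_comm]

/-- ★ **The Kummer exponent is a crossed homomorphism for the cyclotomic character**: for `σ, τ ∈ Γ_F` fixing `u`,
`a(στ) = a(σ) + χ(σ) · a(τ)` in `ℤ_p` — `σ ↦ a(σ)` is a `1`-cocycle with values in `ℤ_p(1) = ℤ_p·ε`, the Kummer cocycle of `u`.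
[cite: SerreGaloisCohomology1997, II §1.2] [cite: BlochKato1990, Ex. 3.10.1] -/
theorem kummerExp_mul (hu : u ≠ 0) {σ τ : absoluteGaloisGroup F} (hσu : σ • u = u) (hτu : τ • u = u)
    (hστu : (σ * τ) • u = u) :
    kummerExp (p := p) (σ * τ) hu hστu =
      kummerExp (p := p) σ hu hσu + ((GaloisRep.cyclotomicCharacter F p σ : ℤ_[p]ˣ) : ℤ_[p]) * kummerExp (p := p) τ hu hτu := by
  refine PadicInt.ext_of_toZModPow.1 fun n => ?_
  haveI : NeZero (p ^ n) := ⟨pow_ne_zero n (Fact.out : p.Prime).ne_zero⟩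
  rw [map_add, map_mul, toZModPow_kummerExp, toZModPow_kummerExp, toZModPow_kummerExp, kummerExpLevel_mul_modEq hu hσu hτu hστu n,
    ZMod.natCast_zmod_val]

/-- `a(1) = 0` (`1 • u_n = u_n = ζ_{pⁿ}^0 u_n`). [cite: SerreGaloisCohomology1997, II §1.2] -/
theorem kummerExp_one (hu : u ≠ 0) (h1u : (1 : absoluteGaloisGroup F) • u = u) : kummerExp (p := p) 1 hu h1u = 0 := by
  refine PadicInt.ext_of_toZModPow.1 fun n => ?_
  haveI : NeZero (p ^ n) := ⟨pow_ne_zero n (Fact.out : p.Prime).ne_zero⟩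
  have h := smul_rootSeq (p := p) 1 hu h1u n
  rw [one_smul] at h
  have h' : (epsRaw p n : NormedAlgClosure F) ^ kummerExpLevel (p := p) 1 hu h1u n * rootSeq p u n = 1 * rootSeq p u n := by
    rw [one_mul]; exact h.symm
  have h1 : (epsRaw p n : NormedAlgClosure F) ^ kummerExpLevel (p := p) 1 hu h1u n = epsRaw p n ^ 0 := by
    rw [pow_zero]; exact mul_right_cancel₀ (rootSeq_ne_zero (p := p) hu n) h'
  have h0 : kummerExpLevel (p := p) 1 hu h1u n = 0 :=
    (isPrimitiveRoot_epsRaw (F := F) (p := p) n).pow_inj (kummerExpLevel_lt (p := p) 1 hu h1u n)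
      (pow_pos (Fact.out : p.Prime).pos n) h1
  rw [toZModPow_kummerExp, h0, Nat.cast_zero, map_zero]

end CocycleLaw

end BdRPlusTop

end Literature.NumberTheory.PAdicHodge

end
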